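import Literature.NumberTheory.Rogawski1990.ArchRankTwoSplitReadingParabolic     -- ★ (KN) p851999: (K1)∕(K3) `normaliser_smul_chartOrbGLoc_eq_smul_integral_unipotent_of_conj_invariant`, `boostFamily_eq_mul_half_mul_half`, the binder frame
import Literature.NumberTheory.Rogawski1990.ArchRankTwoCayleyFibreIntegral       -- ★ FILE C p852134: (C4) `integral_unipotentU_radialCayley_eq_zero`
import Literature.NumberTheory.Rogawski1990.ArchRankTwoRadialCayleyBump          -- ★ FILE D p852172: the radial Cayley bump (invariance, smoothness, support, value on units)
import Literature.Analysis.SpecialFunctions.ShellNullProfile                     -- ★ FILE P p852092: `exists_contDiff_shellNullProfile`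
import Literature.NumberTheory.Rogawski1990.ArchCentralLimitLettersHold          -- ★ `ArchCentralLimitFormulaRankTwo_holds` (the letter, hypothesis-free)
import Literature.NumberTheory.Rogawski1990.ArchCentralDescentAssemblyKit        -- ★ KIT (S1) `ArchCentralLimitFormulaRankTwo.exists_pos_of_frame`
import Literature.NumberTheory.Rogawski1990.ArchInnerTwistChartDictionary        -- ★ `mem_splitChartPlaces_quasiSplitWeights`
import Literature.NumberTheory.Automorphic.ArchCongruenceOrbitalTransport        -- ★ `quasiSplitWeights_ne_zero`, `im_embedding_quasiSplitWeights_eq_zero`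
import Literature.NumberTheory.Automorphic.ArchTorusOrbitalFubiniSmooth          -- ★ `isCompact_setOf_coe_archLocal_mem`
import HarnessLib

/-!
# The corner Euler–Poincaré generator at a place of `U(β₀)`: ONE radial Cayley bump with a shell-null profile has a split-chart reading vanishing
# IDENTICALLY near the scalar corner `ζ·1`, and a non-zero Harish-Chandra letter limit there

Topic `NumberTheory/Rogawski1990`; namespace `Literature.NumberTheory.Automorphic.UnitaryGroup`.  THEOREMS ONLY (no `def`, no instance, no notation, no axiom, no named fact,
no `sorry`).  Cell `pub/hodgecm-mathlib`, crux H413 (`stmt-HodgeConjecture-24833`), half-A line LH2, road «N8-INNER» (LEAD T14-4 (L2)), brick **(10)(B) «CORNER EP GENERATOR,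
ONE PLACE»** of the road owner LH2-plan (g1) — RULING (10)′ 2026-09-02T15:59:16Z («(G1-c) is EXACT»), SIGSHEET (B) v2 3cdc6cba8e426222 «=» 16:35:25Z (rulings (1) `hLetter`
dropped — ★ `ArchCentralLimitFormulaRankTwo_holds`; (4) explicit set kept), statement-first box LHref-N LH2 #12∕#15; seat F0P3a-p08 (g25), FILE B (the head).  Inputs ★:
(KN) `ArchRankTwoSplitReadingParabolic` ((K1)∕(K3), the binder frame), FILE C `ArchRankTwoCayleyFibreIntegral` ((C4) the fibre integral), FILE D `ArchRankTwoRadialCayleyBump`,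
FILE P `ShellNullProfile`, the frame ★ `exists_continuousMulEquiv_archLocal_splitChart_torusU` (with its ambient conjugator `T_w`), ★ `exists_torusU_boostEig_family`,
★ `exists_isCompact_subgroup_unitary_mul_borelU` (`K∞ ⊆ U(3)`), ★ `exists_measure_quotient_torusU_complex_three_eq_smul_map` (`hμC`), ★ `chartHaarGLoc`, ★ `quotientMeasure`,
★ `ArchCentralLimitFormulaRankTwo_holds` + KIT (S1).  Consumers: (C′) «CORNER EP PACKAGE» (F0P3a-p03: compact side + packaging → `EPGeneratorAt`), (12′) EP ASSEMBLY.

THE MATHEMATICS.  `G′_w = U(β₀)_w ≅ U(2,1)` (`β₀ = (½, 1, −½)`: every complex place is a split-chart place), `ζ ∈ S¹` central, `U ∋ ζ·1` a neighbourhood in `M₃(ℂ)`.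
THE GENERATOR: `f₀ = fa ∘ ↑↑`, `fa = ψ ∘ Ad(T_w)`, `ψ(Y) = β(Σ_{ij}|c(ζ⁻¹Y)_{ij}|²) · χ(Σ_{ij}|(ζ⁻¹Y − 1)_{ij}|²)` — `c` the Cayley transform, `β` a SHELL-NULL profile
(★ P: `β ∈ C_c^∞`, `β(0) > 0`, `β ≡ 0` on `[R₀, ∞)`, `∫_{ℂ×ℝ} β(σ + |x|² + t²) = 0` for `0 ≤ σ < R₀∕2`, `R₀ = η²∕3600`), `χ` a smooth step (`≡ 1` on `(−∞, η∕2]`, `≡ 0` on `[η, ∞)`,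
`η = min(⅓, r²∕9)`, `closedBall(ζ·1, r) ⊆ Ad(T_w)(U)`).  By ★ D: `fa ∈ C^∞_c(M₃(ℂ))`, `tsupport fa ⊆ U`, `f₀` is `Ad(K∞)`-invariant in the model, and `ψ(ζX) = β(Σ|c(X)_{ij}|²)` whenever
`1 + X` is invertible.  THE SPLIT READING VANISHES (§2, in the binder frame of ★ (KN)): for `c = (x, φ, θ)` off the wall, ★ (K3) gives
`Δ_w(c) • chartOrbGLoc(f₀)(c) = C • ∫_N f₀(φ_w⁻¹(τ(0,φ,θ) a n a)) dμ_N`, `a = τ(x∕2,0,0)`; `τ(0,φ,θ) a n a = τ(c) · (a⁻¹ n a)` and `n ↦ a⁻¹na` is a topological automorphism of `N`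
(§1), so the integral is `∫_N ψ(↑↑(τ(c) n)) d(Ad(a)_*μ_N)`; for a corner lift `(0, θ₁, θ₂)` (`e^{iθ₁} = e^{iθ₂} = ζ`), `↑↑(τ(c) n) = ζ • ↑↑(τ(c − (0,θ₁,θ₂)) n)` and `1 + τn` is invertible
(upper triangular, §1), so the integrand is `β(Σ|c(τ(c−(0,θ₁,θ₂)) n)_{ij}|²)` and ★ C (C4) (Harish-Chandra's fibre integral of a radial Cayley bump `= K · ∫_{ℂ×ℝ} β(ρ + |x|² + t²)`) kills it as soon
as `ρ = Σ_i |(1 − d_i)∕(1 + d_i)|² < R₀∕2`, `d = boostEig(c − (0,θ₁,θ₂))`; `Δ_w(c) ≠ 0` off the wall.  The set `{ρ < R₀∕2, 1 + d_{0,1} ≠ 0}` is an explicit neighbourhood of EVERY lift of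
the corner (§3, `_explicit`), whence the (B6′) neighbourhood form.  THE LETTER: ★ `ArchCentralLimitFormulaRankTwo_holds` (hypothesis-free) at the frame `(β₀, w)` gives `c′ > 0` with
`Λ₈[ρ′Δ·Φ_{fa}](z) → −c′·I·fa(ζ·1)` through regular torus points, and `fa(ζ·1) = β(0)χ(0) = β(0) ≠ 0`.  No division, no jets, no three bumps: ONE bump, EXACT vanishing
[Rogawski1990 §4.9 (4.9.2) p. 55 (`F_f = Δ ∫_K∫_N`), §8.2 p. 122, §8.4 pp. 126–127; Varadarajan1977 I §1.12; Harish-Chandra 1975 §17 Lemma 17.5].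
HONEST LABEL: HC_CM is proved only modulo the 7 printed citations (2 remaining: hLiu418 = `stmt-HodgeConjecture-24832`, h413 = `stmt-HodgeConjecture-24833`) until rung 0
closes; this file is the one-place CORNER generator of ROAD B for row 2 `stub_N8`, unconditional, count-neutral (+0∕+0).

* §1 `exists_continuousMulEquiv_torusConj`, `isUnit_one_add_torus_mul_unipotent`, `boostEig_apply_eq`;
* §2 **`chartOrbGLoc_radialCayleyBump_eq_zero`** (binder frame of ★ (KN), any `α`, any split-chart place);
* §3 **`exists_centralType_generator_explicit`** (explicit vanishing set, R-727 shape), **`exists_centralType_generator`** (the (B6′) head, neighbourhood form).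

## References
* [Rogawski1990] J. D. Rogawski, *Automorphic Representations of Unitary Groups in Three Variables*, Ann. of Math. Stud. 123 (1990), §1.10 p. 9, §4.9 (4.9.1)–(4.9.2) p. 55,
  §8.2 p. 122, §8.4 pp. 126–127.
* [Varadarajan1977] V. S. Varadarajan, *Harmonic Analysis on Real Reductive Groups*, LNM 576 (1977), Part I §1.12.
* [HarishChandra1975HARRG1] Harish-Chandra, *Harmonic analysis on real reductive groups I*, J. Funct. Anal. 19 (1975), §17 Lemma 17.5.
-/

set_option autoImplicit false

noncomputable section

open MeasureTheory MeasureTheory.Measure NumberField NumberField.InfinitePlace Matrix Complex Topology Filter Set Metric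
open Literature.MeasureTheory.Group Literature.Analysis.Calculus
open scoped MatrixGroups Matrix ENNReal NNReal ContDiff ComplexConjugate Matrix.Norms.Operator

namespace Literature.NumberTheory.Automorphic.UnitaryGroup

/-! ## §1 Auxiliaries on `U(Φ₃)(ℂ)`: torus conjugation of `N` as a topological automorphism, `1 + t·n` is invertible, the boost family at a corner lift -/

section Aux

variable {J : Matrix (Fin 3) (Fin 3) ℂ}

/-- **Conjugation by a torus element is a topological automorphism of `N`** (`n ↦ a⁻¹ n a`, ★ `HeisRing.torusConj`). [cite: Rogawski1990, §1.10 p. 9] -/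
theorem exists_continuousMulEquiv_torusConj (a : ↥(torusU (starRingEnd ℂ) J)) :
    ∃ e : ↥(unipotentU (starRingEnd ℂ) J) ≃ₜ* ↥(unipotentU (starRingEnd ℂ) J),
      ∀ n : ↥(unipotentU (starRingEnd ℂ) J), ((e n : ↥(unipotentU (starRingEnd ℂ) J)) : ↥(unitaryGroupOfForm (starRingEnd ℂ) J)) =
        (a : ↥(unitaryGroupOfForm (starRingEnd ℂ) J))⁻¹ * (n : ↥(unitaryGroupOfForm (starRingEnd ℂ) J)) * (a : ↥(unitaryGroupOfForm (starRingEnd ℂ) J)) := by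
  have hval : ∀ (b : ↥(torusU (starRingEnd ℂ) J)) (n : ↥(unipotentU (starRingEnd ℂ) J)),
      ((HeisRing.torusConj (starRingEnd ℂ) b n : ↥(unipotentU (starRingEnd ℂ) J)) : ↥(unitaryGroupOfForm (starRingEnd ℂ) J)) =
        (b : ↥(unitaryGroupOfForm (starRingEnd ℂ) J))⁻¹ * (n : ↥(unitaryGroupOfForm (starRingEnd ℂ) J)) * (b : ↥(unitaryGroupOfForm (starRingEnd ℂ) J)) :=
    fun b n => rfl
  have hainv : ((a⁻¹ : ↥(torusU (starRingEnd ℂ) J)) : ↥(unitaryGroupOfForm (starRingEnd ℂ) J)) = (a : ↥(unitaryGroupOfForm (starRingEnd ℂ) J))⁻¹ := rfl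
  have hl : Function.LeftInverse (HeisRing.torusConj (starRingEnd ℂ) a⁻¹) (HeisRing.torusConj (starRingEnd ℂ) a) := fun n => by
    apply Subtype.ext
    rw [hval, hval, hainv, inv_inv]
    group
  have hr : Function.RightInverse (HeisRing.torusConj (starRingEnd ℂ) a⁻¹) (HeisRing.torusConj (starRingEnd ℂ) a) := fun n => by
    apply Subtype.ext
    rw [hval, hval, hainv, inv_inv]
    group
  let e0 : ↥(unipotentU (starRingEnd ℂ) J) ≃ ↥(unipotentU (starRingEnd ℂ) J) :=
    ⟨HeisRing.torusConj (starRingEnd ℂ) a, HeisRing.torusConj (starRingEnd ℂ) a⁻¹, hl, hr⟩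
  have hmul : ∀ m n : ↥(unipotentU (starRingEnd ℂ) J), e0 (m * n) = e0 m * e0 n := fun m n => by
    apply Subtype.ext
    show ((HeisRing.torusConj (starRingEnd ℂ) a (m * n) : ↥(unipotentU (starRingEnd ℂ) J)) : ↥(unitaryGroupOfForm (starRingEnd ℂ) J)) =
      ((HeisRing.torusConj (starRingEnd ℂ) a m : ↥(unipotentU (starRingEnd ℂ) J)) : ↥(unitaryGroupOfForm (starRingEnd ℂ) J)) *
        ((HeisRing.torusConj (starRingEnd ℂ) a n : ↥(unipotentU (starRingEnd ℂ) J)) : ↥(unitaryGroupOfForm (starRingEnd ℂ) J))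
    rw [hval, hval, hval, Subgroup.coe_mul]
    group
  let e1 : ↥(unipotentU (starRingEnd ℂ) J) ≃* ↥(unipotentU (starRingEnd ℂ) J) := ⟨e0, hmul⟩
  exact ⟨⟨e1, HeisRing.continuous_torusConj (starRingEnd ℂ) a, HeisRing.continuous_torusConj (starRingEnd ℂ) a⁻¹⟩, fun n => rfl⟩

/-- **`1 + t·n` is invertible** for `t = diag(d)` with `1 + d_i ≠ 0` and `n ∈ N` unitriangular: the matrix is upper triangular with diagonal `1 + d_i`.
[cite: Rogawski1990, §1.10 p. 9] -/
theorem isUnit_one_add_torus_mul_unipotent (t : ↥(torusU (starRingEnd ℂ) J)) {d : Fin 3 → ℂˣ}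
    (hd : glDiagonal 3 ℂ d = ((t : ↥(unitaryGroupOfForm (starRingEnd ℂ) J)) : GL (Fin 3) ℂ)) (hne : ∀ i, 1 + ((d i : ℂˣ) : ℂ) ≠ 0)
    (n : ↥(unipotentU (starRingEnd ℂ) J)) :
    IsUnit ((1 : Matrix (Fin 3) (Fin 3) ℂ) +
      (((t : ↥(unitaryGroupOfForm (starRingEnd ℂ) J)) * (n : ↥(unitaryGroupOfForm (starRingEnd ℂ) J)) : GL (Fin 3) ℂ) : Matrix (Fin 3) (Fin 3) ℂ)) := by
  obtain ⟨hNtri, hNdiag⟩ := (mem_unipotentU_iff (n : ↥(unitaryGroupOfForm (starRingEnd ℂ) J))).1 n.2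
  set U : Matrix (Fin 3) (Fin 3) ℂ := (((n : ↥(unitaryGroupOfForm (starRingEnd ℂ) J)) : GL (Fin 3) ℂ) : Matrix (Fin 3) (Fin 3) ℂ) with hU
  have hmat : (((t : ↥(unitaryGroupOfForm (starRingEnd ℂ) J)) * (n : ↥(unitaryGroupOfForm (starRingEnd ℂ) J)) : GL (Fin 3) ℂ) : Matrix (Fin 3) (Fin 3) ℂ) =
      Matrix.diagonal (fun i => ((d i : ℂˣ) : ℂ)) * U := by
    rw [Units.val_mul, ← hd, coe_glDiagonal]
  rw [hmat]
  have htri : ((1 : Matrix (Fin 3) (Fin 3) ℂ) + Matrix.diagonal (fun i => ((d i : ℂˣ) : ℂ)) * U).BlockTriangular id :=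
    (Matrix.blockTriangular_one).add ((Matrix.blockTriangular_diagonal _).mul hNtri)
  rw [Matrix.isUnit_iff_isUnit_det, Matrix.det_of_upperTriangular htri, isUnit_iff_ne_zero, Finset.prod_ne_zero_iff]
  intro i _
  rw [Matrix.add_apply, Matrix.one_apply_eq, Matrix.diagonal_mul, hNdiag i, mul_one]
  exact hne i

/-- `boostEig` is additive: `diag(boostEig (c + c′)) = diag(boostEig c) · diag(boostEig c′)` through the boost family. [cite: Rogawski1990, §4.9 p. 55] -/
theorem boostEig_apply_eq (c : Fin 3 → ℝ) :
    boostEig c = ![Complex.exp ((c 0 : ℂ) + (c 2 : ℂ) * I), Complex.exp ((c 1 : ℂ) * I), Complex.exp (-(c 0 : ℂ) + (c 2 : ℂ) * I)] := by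
  rfl

end Aux


/-! ## §2 In the binder frame of ★ (KN): the split-chart reading of the radial Cayley bump VANISHES near every corner lift -/

section Frame


variable (L : Type) [Field L] [NumberField L] [IsCMField L] (α : Fin 3 → L) (w : {w : InfinitePlace L // IsComplex w}) (S' : Finset {w : InfinitePlace L // IsComplex w})
  {J : Matrix (Fin 3) (Fin 3) ℂ}
  (φ : ↥(archLocal L 3 (Matrix.diagonal α) w) ≃ₜ* ↥(unitaryGroupOfForm (starRingEnd ℂ) J))
  (hφT : ∀ g : ↥(archLocal L 3 (Matrix.diagonal α) w), φ.toMulEquiv g ∈ torusU (starRingEnd ℂ) J ↔ g ∈ chartTorusGLoc L α w S')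
  (hφd : ∀ cw : Fin 3 → ℝ,
    glDiagonal 3 ℂ (fun i => Units.mk0 (boostEig cw i) (boostEig_ne_zero cw i)) = ((φ (gprimeBlockAt L α w S' cw) : ↥(unitaryGroupOfForm (starRingEnd ℂ) J)) : GL (Fin 3) ℂ))
  (τ : (Fin 3 → ℝ) → ↥(unitaryGroupOfForm (starRingEnd ℂ) J)) (hτT : ∀ c, τ c ∈ torusU (starRingEnd ℂ) J)
  (hτcoe : ∀ c, (((τ c : ↥(unitaryGroupOfForm (starRingEnd ℂ) J)) : GL (Fin 3) ℂ) : Matrix (Fin 3) (Fin 3) ℂ) = Matrix.diagonal (boostEig c))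
  (hτmul : ∀ c c', τ (c + c') = τ c * τ c')
  (hτd : ∀ c, ∃ d : Fin 3 → ℂˣ, glDiagonal 3 ℂ d = ((τ c : ↥(unitaryGroupOfForm (starRingEnd ℂ) J)) : GL (Fin 3) ℂ) ∧ ∀ i, (d i : ℂ) = boostEig c i)
  [MeasurableSpace ↥(archLocal L 3 (Matrix.diagonal α) w)] [BorelSpace ↥(archLocal L 3 (Matrix.diagonal α) w)]
  [LocallyCompactSpace ↥(archLocal L 3 (Matrix.diagonal α) w)] [SecondCountableTopology ↥(archLocal L 3 (Matrix.diagonal α) w)]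
  (νw : Measure ↥(archLocal L 3 (Matrix.diagonal α) w)) [νw.IsHaarMeasure] [νw.IsMulRightInvariant]
  (t : Measure ↥(chartTorusGLoc L α w S')) [t.IsHaarMeasure] [t.IsInvInvariant]
  (hJ : J = (StdForm.antidiagonal 3).over ℂ)
  [MeasurableSpace ↥(unitaryGroupOfForm (starRingEnd ℂ) J)] [BorelSpace ↥(unitaryGroupOfForm (starRingEnd ℂ) J)]
  [MeasurableSpace (↥(unitaryGroupOfForm (starRingEnd ℂ) J) ⧸ torusU (starRingEnd ℂ) J)] [BorelSpace (↥(unitaryGroupOfForm (starRingEnd ℂ) J) ⧸ torusU (starRingEnd ℂ) J)]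
  {K : Subgroup ↥(unitaryGroupOfForm (starRingEnd ℂ) J)} (κ : Measure ↥K) [SFinite κ]
  (μN : Measure ↥(unipotentU (starRingEnd ℂ) J)) [IsHaarMeasure μN] {C : ℝ≥0}
  (hμC : letI : MeasurableSpace (↥(archLocal L 3 (Matrix.diagonal α) w) ⧸ chartTorusGLoc L α w S') := borel _
    haveI : BorelSpace (↥(archLocal L 3 (Matrix.diagonal α) w) ⧸ chartTorusGLoc L α w S') := ⟨rfl⟩
    (quotientMeasure (chartTorusGLoc L α w S') t (isClosed_chartTorusGLoc L α w S') νw).map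
        (cosetCongr φ.toMulEquiv (chartTorusGLoc L α w S') (torusU (starRingEnd ℂ) J) hφT) =
      C • Measure.map
        (fun p : ↥K × ↥(unipotentU (starRingEnd ℂ) J) =>
          (QuotientGroup.mk ((p.1 : ↥(unitaryGroupOfForm (starRingEnd ℂ) J)) * (p.2 : ↥(unitaryGroupOfForm (starRingEnd ℂ) J))) :
            ↥(unitaryGroupOfForm (starRingEnd ℂ) J) ⧸ torusU (starRingEnd ℂ) J))
        (κ.prod μN))

include hJ hφd hμC hτT hτcoe hτmul hτd in
/-- **THE SPLIT READING OF THE RADIAL CAYLEY BUMP VANISHES NEAR THE CORNER** (binder frame of ★ (KN), `K` inside `U(3)`).  Let `ψ(Y) = β(Σ|c(ζ⁻¹Y)_{ij}|²)·χ(Σ|(ζ⁻¹Y−1)_{ij}|²)`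
(★ FILE D; `β` a shell-null profile with null zone `[0, ε)` vanishing on `[R₀, ∞)`, `R₀ ≤ η²∕3600`; `χ ≡ 1` on `(−∞, η∕2]`, `≡ 0` on `[η, ∞)`, `0 < η ≤ 1∕3`; `|ζ| = 1`), and
`f₀ := ψ ∘ ↑↑ ∘ φ` on `U(α)_w`.  For every corner lift `(θ₁, θ₂)` (`e^{iθ₁} = e^{iθ₂} = ζ`) and every `c` off the wall with `1 + boostEig(c − (0,θ₁,θ₂))_{0,1} ≠ 0` and
`ρ = Σ_i |(1 − boostEig(c − (0,θ₁,θ₂))_i)∕(1 + boostEig(c − (0,θ₁,θ₂))_i)|² < ε`: **`chartOrbGLoc L α w S′ ν_w f₀ c = 0`.**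
PROOF: ★ (K3) (`K`-integral drops by `Ad(K)`-invariance, ★ D) ⇒ `Δ(c)•chartOrbGLoc = C•∫_N f₀(φ⁻¹(τ(0,φ,θ) a n a)) dμ_N`; `τ(0,φ,θ) a n a = τ(c)·(a⁻¹na)` and `n ↦ a⁻¹na` is a
topological automorphism of `N` (§1), so the integral is `∫_N ψ(↑↑(τ(c) n)) d(μ_N ∘ Ad a)`; `↑↑(τ c · n) = ζ • ↑↑(τ(c − (0,θ₁,θ₂)) · n)` and `1 + τ·n` is a unit (§1), so by ★ D
the integrand is `β(Σ|c(τ(c−(0,θ₁,θ₂)) n)_{ij}|²)`, whose integral vanishes by ★ FILE C (C4); finally `Δ(c) ≠ 0` off the wall. [cite: Rogawski1990, §4.9 (4.9.2) p. 55; §8.2 p. 122]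
[cite: Varadarajan1977, I §1.12] -/
theorem chartOrbGLoc_radialCayleyBump_eq_zero
    (hKU : ∀ k : ↥K, (((k : ↥(unitaryGroupOfForm (starRingEnd ℂ) J)) : GL (Fin 3) ℂ) : Matrix (Fin 3) (Fin 3) ℂ) ∈ Matrix.unitaryGroup (Fin 3) ℂ)
    (β χ : ℝ → ℝ) (hβ : ContDiff ℝ ∞ β) (hχ : ContDiff ℝ ∞ χ) {η R₀ ε : ℝ} (hη : 0 < η) (hη3 : η ≤ 1 / 3)
    (hχ0 : ∀ s, η ≤ s → χ s = 0) (hχ1 : ∀ s, s ≤ η / 2 → χ s = 1) (hR₀ : R₀ ≤ η ^ 2 / 3600) (hβR : ∀ u, R₀ ≤ u → β u = 0)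
    (hnull : ∀ σ, 0 ≤ σ → σ < ε → ∫ p : ℂ × ℝ, β (σ + ‖p.1‖ ^ 2 + p.2 ^ 2) = 0)
    (ζ : ℂ) (hζ : ‖ζ‖ = 1) (θ₁ θ₂ : ℝ) (hθ₁ : Complex.exp ((θ₁ : ℂ) * I) = ζ) (hθ₂ : Complex.exp ((θ₂ : ℂ) * I) = ζ)
    (cw : Fin 3 → ℝ) (hx : cw 0 ≠ 0) (h0 : 1 + boostEig (cw - ![0, θ₁, θ₂]) 0 ≠ 0) (h1 : 1 + boostEig (cw - ![0, θ₁, θ₂]) 1 ≠ 0)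
    (hρ : (∑ i, ‖(1 - boostEig (cw - ![0, θ₁, θ₂]) i) / (1 + boostEig (cw - ![0, θ₁, θ₂]) i)‖ ^ 2) < ε) :
    chartOrbGLoc L α w S' νw (fun g : ↥(archLocal L 3 (Matrix.diagonal α) w) =>
      ((β (∑ i, ∑ j, ‖cayley (ζ⁻¹ • (((φ g : ↥(unitaryGroupOfForm (starRingEnd ℂ) J)) : GL (Fin 3) ℂ) : Matrix (Fin 3) (Fin 3) ℂ)) i j‖ ^ 2) *
        χ (∑ i, ∑ j, ‖(ζ⁻¹ • (((φ g : ↥(unitaryGroupOfForm (starRingEnd ℂ) J)) : GL (Fin 3) ℂ) : Matrix (Fin 3) (Fin 3) ℂ) - 1) i j‖ ^ 2) : ℝ) : ℂ)) cw = 0 := by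
  haveI : BorelSpace ↥(unipotentU (starRingEnd ℂ) J) := Subtype.borelSpace _
  haveI : LocallyCompactSpace ↥(unitaryGroupOfForm (starRingEnd ℂ) J) := locallyCompactSpace_unitaryGroupOfForm_complex J
  haveI : SecondCountableTopology ↥(unitaryGroupOfForm (starRingEnd ℂ) J) := secondCountableTopology_unitaryGroupOfForm_complex J
  have hN : IsClosed (unipotentU (starRingEnd ℂ) J : Set ↥(unitaryGroupOfForm (starRingEnd ℂ) J)) := LineRing.isClosed_unipotentU _ _
  haveI : LocallyCompactSpace ↥(unipotentU (starRingEnd ℂ) J) := hN.isClosedEmbedding_subtypeVal.locallyCompactSpace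
  haveI : SecondCountableTopology ↥(unipotentU (starRingEnd ℂ) J) := TopologicalSpace.Subtype.secondCountableTopology _
  have hζ0 : ζ ≠ 0 := norm_ne_zero_iff.1 (by rw [hζ]; exact one_ne_zero)
  -- the model-side bump `ψ` and the test function `f₀ = ψ ∘ ↑↑ ∘ φ`
  set ψ : Matrix (Fin 3) (Fin 3) ℂ → ℝ := fun Y =>
    β (∑ i, ∑ j, ‖cayley (ζ⁻¹ • Y) i j‖ ^ 2) * χ (∑ i, ∑ j, ‖(ζ⁻¹ • Y - 1) i j‖ ^ 2) with hψ
  set f₀ : ↥(archLocal L 3 (Matrix.diagonal α) w) → ℂ := fun g =>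
    ((ψ (((φ g : ↥(unitaryGroupOfForm (starRingEnd ℂ) J)) : GL (Fin 3) ℂ) : Matrix (Fin 3) (Fin 3) ℂ) : ℝ) : ℂ) with hf₀
  have hψs : ContDiff ℝ ∞ ψ := contDiff_radialCayleyBump β χ ζ hβ hχ hη3 hχ0
  have hmatc : Continuous fun v : ↥(unitaryGroupOfForm (starRingEnd ℂ) J) => ((v : GL (Fin 3) ℂ) : Matrix (Fin 3) (Fin 3) ℂ) :=
    Units.continuous_val.comp continuous_subtype_val
  have hf₀c : Continuous f₀ := Complex.continuous_ofReal.comp (hψs.continuous.comp (hmatc.comp φ.continuous))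
  have hF : ∀ v : ↥(unitaryGroupOfForm (starRingEnd ℂ) J), f₀ (φ.symm v) = ((ψ ((v : GL (Fin 3) ℂ) : Matrix (Fin 3) (Fin 3) ℂ) : ℝ) : ℂ) := fun v => by
    simp only [hf₀, ContinuousMulEquiv.apply_symm_apply]
  -- `Ad(K)`-invariance (★ D: `K ⊆ U(3)`)
  have hfK : ∀ (k : ↥K) (g : ↥(unitaryGroupOfForm (starRingEnd ℂ) J)),
      f₀ (φ.symm ((k : ↥(unitaryGroupOfForm (starRingEnd ℂ) J)) * g * (k : ↥(unitaryGroupOfForm (starRingEnd ℂ) J))⁻¹)) = f₀ (φ.symm g) := fun k g => by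
    rw [hF, hF, Subgroup.coe_mul, Subgroup.coe_mul, Subgroup.coe_inv, Units.val_mul, Units.val_mul, Matrix.coe_units_inv]
    simp only [hψ]
    rw [radialCayleyBump_unitary_conj β χ ζ _ (hKU k)]
  -- (K3): the `K`-integral drops
  have hK3 := normaliser_smul_chartOrbGLoc_eq_smul_integral_unipotent_of_conj_invariant L α w S' φ hφT hφd τ hτT hτcoe hτmul hτd νw t hJ κ μN hμC
    f₀ hf₀c hfK cw hx
  -- the fibre integral vanishes
  set a : ↥(unitaryGroupOfForm (starRingEnd ℂ) J) := τ ![cw 0 / 2, 0, 0] with ha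
  obtain ⟨e, he⟩ := exists_continuousMulEquiv_torusConj (J := J) ⟨a, hτT _⟩
  set c' : Fin 3 → ℝ := cw - ![0, θ₁, θ₂] with hc'
  obtain ⟨d, hd, hdi⟩ := hτd c'
  have hcw : cw = ![0, θ₁, θ₂] + c' := by rw [hc']; abel
  have hcentral : (((τ ![0, θ₁, θ₂] : ↥(unitaryGroupOfForm (starRingEnd ℂ) J)) : GL (Fin 3) ℂ) : Matrix (Fin 3) (Fin 3) ℂ) = ζ • (1 : Matrix (Fin 3) (Fin 3) ℂ) := by
    rw [hτcoe, boostEig_apply_eq, Matrix.smul_one_eq_diagonal]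
    congr 1
    funext i
    fin_cases i
    · show Complex.exp (((![0, θ₁, θ₂] : Fin 3 → ℝ) 0 : ℂ) + ((![0, θ₁, θ₂] : Fin 3 → ℝ) 2 : ℂ) * I) = ζ
      simp [hθ₂]
    · show Complex.exp (((![0, θ₁, θ₂] : Fin 3 → ℝ) 1 : ℂ) * I) = ζ
      simp [hθ₁]
    · show Complex.exp (-((![0, θ₁, θ₂] : Fin 3 → ℝ) 0 : ℂ) + ((![0, θ₁, θ₂] : Fin 3 → ℝ) 2 : ℂ) * I) = ζ
      simp [hθ₂]
  have hmat : ∀ n : ↥(unipotentU (starRingEnd ℂ) J),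
      ((((τ cw * (n : ↥(unitaryGroupOfForm (starRingEnd ℂ) J))) : ↥(unitaryGroupOfForm (starRingEnd ℂ) J)) : GL (Fin 3) ℂ) : Matrix (Fin 3) (Fin 3) ℂ) =
        ζ • ((((τ c' * (n : ↥(unitaryGroupOfForm (starRingEnd ℂ) J))) : ↥(unitaryGroupOfForm (starRingEnd ℂ) J)) : GL (Fin 3) ℂ) : Matrix (Fin 3) (Fin 3) ℂ) :=
    fun n => by
    rw [hcw, hτmul, mul_assoc]
    simp only [Subgroup.coe_mul, Units.val_mul]
    rw [hcentral, smul_mul_assoc, one_mul]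
  -- the torus element `τ c′` and `1 + d_i ≠ 0`
  have h0' : 1 + ((d 0 : ℂˣ) : ℂ) ≠ 0 := by rw [hdi 0]; exact h0
  have h1' : 1 + ((d 1 : ℂˣ) : ℂ) ≠ 0 := by rw [hdi 1]; exact h1
  obtain ⟨-, hd2⟩ := norm_diag_one_eq_one_and_diag_two_eq hJ ⟨τ c', hτT c'⟩ hd
  have h2' : 1 + ((d 2 : ℂˣ) : ℂ) ≠ 0 := by
    rw [hd2]
    have hc0 : conj ((d 0 : ℂˣ) : ℂ) ≠ 0 := by rw [Ne, map_eq_zero]; exact (d 0).ne_zero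
    have hc1 : conj (1 + ((d 0 : ℂˣ) : ℂ)) ≠ 0 := by rw [Ne, map_eq_zero]; exact h0'
    rw [show (1 : ℂ) + (conj ((d 0 : ℂˣ) : ℂ))⁻¹ = conj (1 + ((d 0 : ℂˣ) : ℂ)) / conj ((d 0 : ℂˣ) : ℂ) by rw [map_add, map_one]; field_simp; ring]
    exact div_ne_zero hc1 hc0
  have hne : ∀ i, 1 + ((d i : ℂˣ) : ℂ) ≠ 0 := fun i => by fin_cases i <;> assumption
  have hρ' : (∑ i, ‖(1 - ((d i : ℂˣ) : ℂ)) / (1 + ((d i : ℂˣ) : ℂ))‖ ^ 2) < ε := by simp_rw [hdi]; exact hρ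
  -- the integrand along the fibre
  have hG : ∀ n : ↥(unipotentU (starRingEnd ℂ) J), f₀ (φ.symm (τ cw * (e n : ↥(unitaryGroupOfForm (starRingEnd ℂ) J)))) =
      ((β (∑ i, ∑ j, ‖cayley (((((⟨τ c', hτT c'⟩ : ↥(torusU (starRingEnd ℂ) J)) : ↥(unitaryGroupOfForm (starRingEnd ℂ) J)) *
        ((e n : ↥(unipotentU (starRingEnd ℂ) J)) : ↥(unitaryGroupOfForm (starRingEnd ℂ) J)) : GL (Fin 3) ℂ) : Matrix (Fin 3) (Fin 3) ℂ)) i j‖ ^ 2) : ℝ) : ℂ) :=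
    fun n => by
    rw [hF, hmat (e n)]
    simp only [hψ]
    have hXu : IsUnit ((1 : Matrix (Fin 3) (Fin 3) ℂ) +
        ((((τ c' * ((e n : ↥(unipotentU (starRingEnd ℂ) J)) : ↥(unitaryGroupOfForm (starRingEnd ℂ) J))) : ↥(unitaryGroupOfForm (starRingEnd ℂ) J)) :
          GL (Fin 3) ℂ) : Matrix (Fin 3) (Fin 3) ℂ)) := by
      simpa [Subgroup.coe_mul] using isUnit_one_add_torus_mul_unipotent ⟨τ c', hτT c'⟩ hd hne (e n)
    rw [radialCayleyBump_smul_eq_of_isUnit β χ ζ hη (by linarith) hχ1 hR₀ hβR hζ0 _ hXu]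
    simp only [Subgroup.coe_mul]
  have hprod : ∀ n : ↥(unipotentU (starRingEnd ℂ) J),
      τ ![0, cw 1, cw 2] * τ ![cw 0 / 2, 0, 0] * (n : ↥(unitaryGroupOfForm (starRingEnd ℂ) J)) * τ ![cw 0 / 2, 0, 0] =
        τ cw * ((e n : ↥(unipotentU (starRingEnd ℂ) J)) : ↥(unitaryGroupOfForm (starRingEnd ℂ) J)) := fun n => by
    rw [he n, boostFamily_eq_mul_half_mul_half τ hτmul cw]
    simp only [← ha]
    group
  haveI : (Measure.map e μN).IsHaarMeasure := e.isHaarMeasure_map μN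
  have hint : ∫ n : ↥(unipotentU (starRingEnd ℂ) J),
      f₀ (φ.symm (τ ![0, cw 1, cw 2] * τ ![cw 0 / 2, 0, 0] * (n : ↥(unitaryGroupOfForm (starRingEnd ℂ) J)) * τ ![cw 0 / 2, 0, 0])) ∂μN = 0 := by
    simp_rw [hprod]
    have hmap := (e.toHomeomorph.measurableEmbedding).integral_map (μ := μN)
      (fun n' : ↥(unipotentU (starRingEnd ℂ) J) => f₀ (φ.symm (τ cw * (n' : ↥(unitaryGroupOfForm (starRingEnd ℂ) J)))))
    rw [show (fun n : ↥(unipotentU (starRingEnd ℂ) J) => f₀ (φ.symm (τ cw * ((e n : ↥(unipotentU (starRingEnd ℂ) J)) : ↥(unitaryGroupOfForm (starRingEnd ℂ) J)))))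
      = fun n => f₀ (φ.symm (τ cw * ((e.toHomeomorph n : ↥(unipotentU (starRingEnd ℂ) J)) : ↥(unitaryGroupOfForm (starRingEnd ℂ) J)))) from rfl, ← hmap]
    have hG' : (fun n' : ↥(unipotentU (starRingEnd ℂ) J) => f₀ (φ.symm (τ cw * (n' : ↥(unitaryGroupOfForm (starRingEnd ℂ) J))))) =
        fun n' : ↥(unipotentU (starRingEnd ℂ) J) =>
        ((β (∑ i, ∑ j, ‖cayley (((((⟨τ c', hτT c'⟩ : ↥(torusU (starRingEnd ℂ) J)) : ↥(unitaryGroupOfForm (starRingEnd ℂ) J)) *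
          (n' : ↥(unitaryGroupOfForm (starRingEnd ℂ) J)) : GL (Fin 3) ℂ) : Matrix (Fin 3) (Fin 3) ℂ)) i j‖ ^ 2) : ℝ) : ℂ) := by
      funext n'
      have := hG (e.symm n')
      rwa [ContinuousMulEquiv.apply_symm_apply] at this
    rw [show (⇑e.toHomeomorph : ↥(unipotentU (starRingEnd ℂ) J) → ↥(unipotentU (starRingEnd ℂ) J)) = ⇑e from rfl, hG', integral_complex_ofReal,
      integral_unipotentU_radialCayley_eq_zero hJ (Measure.map e μN) β hβ.continuous hβR hnull ⟨τ c', hτT c'⟩ hd h0' h1' hρ', Complex.ofReal_zero]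
  rw [hint, smul_zero] at hK3
  -- `Δ(c) ≠ 0` off the wall
  have hΔ : |Real.exp (cw 0) - Real.exp (-cw 0)| * ‖Complex.exp ((cw 0 : ℂ) + (cw 2 : ℂ) * I) - Complex.exp ((cw 1 : ℂ) * I)‖ *
      ‖Complex.exp (-(cw 0 : ℂ) + (cw 2 : ℂ) * I) - Complex.exp ((cw 1 : ℂ) * I)‖ ≠ 0 := by
    have hA : Real.exp (cw 0) - Real.exp (-cw 0) ≠ 0 := by
      intro h
      have := Real.exp_injective (sub_eq_zero.1 h)
      exact hx (by linarith)
    have hB : ∀ s : ℝ, s ≠ 0 → ‖Complex.exp ((s : ℂ) + (cw 2 : ℂ) * I) - Complex.exp ((cw 1 : ℂ) * I)‖ ≠ 0 := fun s hs => by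
      rw [norm_ne_zero_iff, sub_ne_zero]
      intro h
      have hn := congrArg (fun z : ℂ => ‖z‖) h
      simp only [Complex.norm_exp, Complex.add_re, Complex.ofReal_re, Complex.mul_re, Complex.I_re, Complex.I_im, Complex.ofReal_im,
        mul_zero, mul_one, sub_self, add_zero] at hn
      exact hs (by simpa using hn)
    have hB' := hB (cw 0) hx
    have hC' : ‖Complex.exp (-(cw 0 : ℂ) + (cw 2 : ℂ) * I) - Complex.exp ((cw 1 : ℂ) * I)‖ ≠ 0 := by
      have := hB (-cw 0) (neg_ne_zero.2 hx)
      simpa using this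
    exact mul_ne_zero (mul_ne_zero (abs_ne_zero.2 hA) hB') hC'
  exact (smul_eq_zero.1 hK3).resolve_left hΔ

end Frame


/-! ## §3 THE HEAD at the quasi-split frame `β₀ = (½, 1, −½)`: the corner Euler–Poincaré generator -/

section Head

variable (L : Type) [Field L] [NumberField L] [IsCMField L] (w : {w : InfinitePlace L // IsComplex w})

/-- **(B) THE CORNER EULER–POINCARÉ GENERATOR AT ONE PLACE — EXACT, ONE BUMP, NO DIVISION.**  At every complex place `w` of the quasi-split house frame
`β₀ = (½, 1, −½)` (all split-chart places), for every central `ζ ∈ S¹` and every neighbourhood `U` of `ζ·1` in `M₃(ℂ)`, there is an ambient test function `fa ∈ C^∞_c(M₃(ℂ))`,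
`tsupport fa ⊆ U`, with compactly supported restriction `f₀ = fa ∘ ↑↑` to `U(β₀)_w`, and `ℓ ≠ 0`, such that
(G1-c) **the split-chart reading `chartOrbGLoc L β₀ w S′ ν_w f₀` VANISHES on a neighbourhood of EVERY lift `(0, θ₁, θ₂)` of the scalar corner** (`e^{iθ₁} = e^{iθ₂} = ζ`), off the wall; and
(G3-c) **Harish-Chandra's letter functional `Λ₈[ρ′Δ·Φ_{fa}]` tends to `ℓ` at the corner through regular torus points** (★ `ArchCentralLimitFormulaRankTwo_holds`, hypothesis-free).
CONSTRUCTION: `fa = ψ ∘ Ad(T_w)`, `ψ(Y) = β(Σ|c(ζ⁻¹Y)_{ij}|²)·χ(Σ|(ζ⁻¹Y−1)_{ij}|²)` the radial Cayley bump (★ D) with a SHELL-NULL profile `β` (★ P: `∫_{ℂ×ℝ} β(σ+|x|²+t²) = 0` for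
`0 ≤ σ < ε`, `β(0) > 0`); the split reading is Harish-Chandra's fibre integral (★ (K1)∕(K3) + §1's torus conjugation of `μ_N`), which ★ C (C4) kills for `ρ(c) < ε`; `ℓ = −c′·I·β(0)·χ(0) ≠ 0`.
[cite: Rogawski1990, §4.9 (4.9.2) p. 55; §8.2 p. 122; §8.4 pp. 126–127] [cite: Varadarajan1977, I §1.12] [cite: HarishChandra1975HARRG1, §17 Lemma 17.5] -/
theorem exists_centralType_generator_explicit
    [MeasurableSpace ↥(archLocal L 3 (Matrix.diagonal ![(2 : L)⁻¹, 1, -(2 : L)⁻¹]) w)] [BorelSpace ↥(archLocal L 3 (Matrix.diagonal ![(2 : L)⁻¹, 1, -(2 : L)⁻¹]) w)] [LocallyCompactSpace ↥(archLocal L 3 (Matrix.diagonal ![(2 : L)⁻¹, 1, -(2 : L)⁻¹]) w)] [SecondCountableTopology ↥(archLocal L 3 (Matrix.diagonal ![(2 : L)⁻¹, 1, -(2 : L)⁻¹]) w)]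
    (νw : Measure ↥(archLocal L 3 (Matrix.diagonal ![(2 : L)⁻¹, 1, -(2 : L)⁻¹]) w)) [νw.IsHaarMeasure] [νw.IsMulRightInvariant]
    (S' : Finset {w : InfinitePlace L // IsComplex w}) (hS' : w ∈ S')
    (ζ : Circle) {U : Set (Matrix (Fin 3) (Fin 3) ℂ)} (hU : U ∈ 𝓝 ((ζ : ℂ) • (1 : Matrix (Fin 3) (Fin 3) ℂ))) :
    ∃ (fa : Matrix (Fin 3) (Fin 3) ℂ → ℂ) (ℓ : ℂ) (ε' : ℝ), 0 < ε' ∧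
      ContDiff ℝ ∞ fa ∧ HasCompactSupport fa ∧ tsupport fa ⊆ U ∧
      HasCompactSupport (fun g : ↥(archLocal L 3 (Matrix.diagonal ![(2 : L)⁻¹, 1, -(2 : L)⁻¹]) w) => fa ((g : GL (Fin 3) ℂ) : Matrix (Fin 3) (Fin 3) ℂ)) ∧ ℓ ≠ 0 ∧
      (∀ θ₁ θ₂ : ℝ, Circle.exp θ₁ = ζ → Circle.exp θ₂ = ζ → ∀ cw : Fin 3 → ℝ, cw 0 ≠ 0 →
        1 + boostEig (cw - ![0, θ₁, θ₂]) 0 ≠ 0 → 1 + boostEig (cw - ![0, θ₁, θ₂]) 1 ≠ 0 →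
        (∑ i, ‖(1 - boostEig (cw - ![0, θ₁, θ₂]) i) / (1 + boostEig (cw - ![0, θ₁, θ₂]) i)‖ ^ 2) < ε' →
          chartOrbGLoc L ![(2 : L)⁻¹, 1, -(2 : L)⁻¹] w S' νw (fun g : ↥(archLocal L 3 (Matrix.diagonal ![(2 : L)⁻¹, 1, -(2 : L)⁻¹]) w) => fa ((g : GL (Fin 3) ℂ) : Matrix (Fin 3) (Fin 3) ℂ)) cw = 0) ∧
      Tendsto (fun z : Fin 3 → Circle =>
          (1 / 48 : ℂ) * ∑ ε : Fin 3 → Bool, ((((if ε 0 then (1 : ℝ) else -1) * (if ε 1 then (1 : ℝ) else -1) * (if ε 2 then (1 : ℝ) else -1) : ℝ)) : ℂ) *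
            iteratedDeriv 3 (fun s : ℝ => ((((z 0 * Circle.exp (s * (![(if ε 0 then (1 : ℝ) else -1) + (if ε 1 then (1 : ℝ) else -1), -(if ε 0 then (1 : ℝ) else -1) + (if ε 2 then (1 : ℝ) else -1), -(if ε 1 then (1 : ℝ) else -1) - (if ε 2 then (1 : ℝ) else -1)] 0)) : Circle) : ℂ)) * (((z 2 * Circle.exp (s * (![(if ε 0 then (1 : ℝ) else -1) + (if ε 1 then (1 : ℝ) else -1), -(if ε 0 then (1 : ℝ) else -1) + (if ε 2 then (1 : ℝ) else -1), -(if ε 1 then (1 : ℝ) else -1) - (if ε 2 then (1 : ℝ) else -1)] 2)) : Circle) : ℂ))⁻¹) * ((1 - (((z 1 * Circle.exp (s * (![(if ε 0 then (1 : ℝ) else -1) + (if ε 1 then (1 : ℝ) else -1), -(if ε 0 then (1 : ℝ) else -1) + (if ε 2 then (1 : ℝ) else -1), -(if ε 1 then (1 : ℝ) else -1) - (if ε 2 then (1 : ℝ) else -1)] 1)) : Circle) : ℂ)) * (((z 0 * Circle.exp (s * (![(if ε 0 then (1 : ℝ) else -1) + (if ε 1 then (1 : ℝ) else -1), -(if ε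 0 then (1 : ℝ) else -1) + (if ε 2 then (1 : ℝ) else -1), -(if ε 1 then (1 : ℝ) else -1) - (if ε 2 then (1 : ℝ) else -1)] 0)) : Circle) : ℂ))⁻¹) * (1 - (((z 2 * Circle.exp (s * (![(if ε 0 then (1 : ℝ) else -1) + (if ε 1 then (1 : ℝ) else -1), -(if ε 0 then (1 : ℝ) else -1) + (if ε 2 then (1 : ℝ) else -1), -(if ε 1 then (1 : ℝ) else -1) - (if ε 2 then (1 : ℝ) else -1)] 2)) : Circle) : ℂ)) * (((z 1 * Circle.exp (s * (![(if ε 0 then (1 : ℝ) else -1) + (if ε 1 then (1 : ℝ) else -1), -(if ε 0 then (1 : ℝ) else -1) + (if ε 2 then (1 : ℝ) else -1), -(if ε 1 then (1 : ℝ) else -1) - (if ε 2 then (1 : ℝ) else -1)] 1)) : Circle) : ℂ))⁻¹) * (1 - (((z 2 * Circle.exp (s * (![(if ε 0 then (1 : ℝ) else -1) + (if ε 1 then (1 : ℝ) else -1), -(if ε 0 then (1 : ℝ) else -1) + (if ε 2 then (1 : ℝ) else -1), -(if ε 1 then (1 : ℝ) else -1) - (if ε 2 then (1 : ℝ) else -1)]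 2)) : Circle) : ℂ)) * (((z 0 * Circle.exp (s * (![(if ε 0 then (1 : ℝ) else -1) + (if ε 1 then (1 : ℝ) else -1), -(if ε 0 then (1 : ℝ) else -1) + (if ε 2 then (1 : ℝ) else -1), -(if ε 1 then (1 : ℝ) else -1) - (if ε 2 then (1 : ℝ) else -1)] 0)) : Circle) : ℂ))⁻¹)) * (∫ g, fa (((g * ⟨circleDiagonal 3 (fun k => z k * Circle.exp (s * (![(if ε 0 then (1 : ℝ) else -1) + (if ε 1 then (1 : ℝ) else -1), -(if ε 0 then (1 : ℝ) else -1) + (if ε 2 then (1 : ℝ) else -1), -(if ε 1 then (1 : ℝ) else -1) - (if ε 2 then (1 : ℝ) else -1)] k))), circleDiagonal_mem_archLocal_diagonal L 3 ![(2 : L)⁻¹, 1, -(2 : L)⁻¹] w _⟩ * g⁻¹ : archLocal L 3 (Matrix.diagonal ![(2 : L)⁻¹, 1, -(2 : L)⁻¹]) w) : GL (Fin 3) ℂ) : Matrix (Fin 3) (Fin 3) ℂ) ∂νw)) 0)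
        (𝓝[{z : Fin 3 → Circle | Function.Injective z}] (fun _ => ζ))
        (𝓝 ℓ) := by
  classical
  have hα : ∀ i, ![(2 : L)⁻¹, 1, -(2 : L)⁻¹] i ≠ 0 := quasiSplitWeights_ne_zero L
  have hsp : w ∈ splitChartPlaces L ![(2 : L)⁻¹, 1, -(2 : L)⁻¹] := Literature.NumberTheory.Rogawski1990.mem_splitChartPlaces_quasiSplitWeights L w
  have hS'all : ∀ v, v ∈ S' → v ∈ splitChartPlaces L ![(2 : L)⁻¹, 1, -(2 : L)⁻¹] := fun v _ => Literature.NumberTheory.Rogawski1990.mem_splitChartPlaces_quasiSplitWeights L v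
  set J : Matrix (Fin 3) (Fin 3) ℂ := (StdForm.antidiagonal 3).over ℂ with hJdef
  have hJ : J = (StdForm.antidiagonal 3).over ℂ := rfl
  -- Borel structures on the model group and the two quotients
  letI : MeasurableSpace ↥(unitaryGroupOfForm (starRingEnd ℂ) J) := borel _
  haveI : BorelSpace ↥(unitaryGroupOfForm (starRingEnd ℂ) J) := ⟨rfl⟩
  letI : MeasurableSpace (↥(unitaryGroupOfForm (starRingEnd ℂ) J) ⧸ torusU (starRingEnd ℂ) J) := borel _
  haveI : BorelSpace (↥(unitaryGroupOfForm (starRingEnd ℂ) J) ⧸ torusU (starRingEnd ℂ) J) := ⟨rfl⟩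
  letI : MeasurableSpace (↥(archLocal L 3 (Matrix.diagonal ![(2 : L)⁻¹, 1, -(2 : L)⁻¹]) w) ⧸ chartTorusGLoc L ![(2 : L)⁻¹, 1, -(2 : L)⁻¹] w S') := borel _
  haveI : BorelSpace (↥(archLocal L 3 (Matrix.diagonal ![(2 : L)⁻¹, 1, -(2 : L)⁻¹]) w) ⧸ chartTorusGLoc L ![(2 : L)⁻¹, 1, -(2 : L)⁻¹] w S') := ⟨rfl⟩
  haveI : LocallyCompactSpace ↥(unitaryGroupOfForm (starRingEnd ℂ) J) := locallyCompactSpace_unitaryGroupOfForm_complex J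
  haveI : SecondCountableTopology ↥(unitaryGroupOfForm (starRingEnd ℂ) J) := secondCountableTopology_unitaryGroupOfForm_complex J
  have hNc : IsClosed (unipotentU (starRingEnd ℂ) J : Set ↥(unitaryGroupOfForm (starRingEnd ℂ) J)) := LineRing.isClosed_unipotentU _ _
  haveI : LocallyCompactSpace ↥(unipotentU (starRingEnd ℂ) J) := hNc.isClosedEmbedding_subtypeVal.locallyCompactSpace
  haveI : SecondCountableTopology ↥(unipotentU (starRingEnd ℂ) J) := TopologicalSpace.Subtype.secondCountableTopology _
  haveI : BorelSpace ↥(unipotentU (starRingEnd ℂ) J) := Subtype.borelSpace _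
  have hTc : IsClosed (torusU (starRingEnd ℂ) J : Set ↥(unitaryGroupOfForm (starRingEnd ℂ) J)) := isClosed_torusU_of_t1Space _ _
  haveI : LocallyCompactSpace ↥(torusU (starRingEnd ℂ) J) := hTc.isClosedEmbedding_subtypeVal.locallyCompactSpace
  haveI : BorelSpace ↥(torusU (starRingEnd ℂ) J) := Subtype.borelSpace _
  -- the frame, the boost family, `K∞`
  obtain ⟨φ, hφ, ⟨T, hT⟩, hφT0⟩ := exists_continuousMulEquiv_archLocal_splitChart_torusU L ![(2 : L)⁻¹, 1, -(2 : L)⁻¹] w hα hsp hJ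
  have hφT : ∀ g : ↥(archLocal L 3 (Matrix.diagonal ![(2 : L)⁻¹, 1, -(2 : L)⁻¹]) w), φ.toMulEquiv g ∈ torusU (starRingEnd ℂ) J ↔ g ∈ chartTorusGLoc L ![(2 : L)⁻¹, 1, -(2 : L)⁻¹] w S' := hφT0 S' hS'all hS'
  have hφd : ∀ cw : Fin 3 → ℝ, glDiagonal 3 ℂ (fun i => Units.mk0 (boostEig cw i) (boostEig_ne_zero cw i)) =
      ((φ (gprimeBlockAt L ![(2 : L)⁻¹, 1, -(2 : L)⁻¹] w S' cw) : ↥(unitaryGroupOfForm (starRingEnd ℂ) J)) : GL (Fin 3) ℂ) := fun cw => (hφ S' (fun _ => cw) hS').2.1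
  obtain ⟨τ, hτT, hτcoe, hτmul, hτd⟩ := exists_torusU_boostEig_family hJ
  obtain ⟨K, hK, hKmem, hKB⟩ := exists_isCompact_subgroup_unitary_mul_borelU hJ
  have hKU : ∀ k : ↥K, (((k : ↥(unitaryGroupOfForm (starRingEnd ℂ) J)) : GL (Fin 3) ℂ) : Matrix (Fin 3) (Fin 3) ℂ) ∈ Matrix.unitaryGroup (Fin 3) ℂ := fun k => (hKmem k).1 k.2
  haveI : LocallyCompactSpace ↥K := hK.isClosed.isClosedEmbedding_subtypeVal.locallyCompactSpace
  haveI : BorelSpace ↥K := Subtype.borelSpace _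
  -- measures: Haar on `K`, `N`, the torus; the chart Haar on `T′`; the transported quotient measure and its `hμC`
  set κ : Measure ↥K := Measure.haar with hκ
  set μN : Measure ↥(unipotentU (starRingEnd ℂ) J) := Measure.haar with hμN
  set αT : Measure ↥(torusU (starRingEnd ℂ) J) := Measure.haar with hαT
  set t : Measure ↥(chartTorusGLoc L ![(2 : L)⁻¹, 1, -(2 : L)⁻¹] w S') := chartHaarGLoc L ![(2 : L)⁻¹, 1, -(2 : L)⁻¹] w S' with ht
  haveI : t.IsHaarMeasure := isHaarMeasure_chartHaarGLoc L ![(2 : L)⁻¹, 1, -(2 : L)⁻¹] w S'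
  haveI : t.IsInvInvariant := isInvInvariant_chartHaarGLoc L ![(2 : L)⁻¹, 1, -(2 : L)⁻¹] w S'
  set μq : Measure (↥(archLocal L 3 (Matrix.diagonal ![(2 : L)⁻¹, 1, -(2 : L)⁻¹]) w) ⧸ chartTorusGLoc L ![(2 : L)⁻¹, 1, -(2 : L)⁻¹] w S') := quotientMeasure (chartTorusGLoc L ![(2 : L)⁻¹, 1, -(2 : L)⁻¹] w S') t (isClosed_chartTorusGLoc L ![(2 : L)⁻¹, 1, -(2 : L)⁻¹] w S') νw with hμq
  haveI : SMulInvariantMeasure ↥(archLocal L 3 (Matrix.diagonal ![(2 : L)⁻¹, 1, -(2 : L)⁻¹]) w) (↥(archLocal L 3 (Matrix.diagonal ![(2 : L)⁻¹, 1, -(2 : L)⁻¹]) w) ⧸ chartTorusGLoc L ![(2 : L)⁻¹, 1, -(2 : L)⁻¹] w S') μq := smulInvariantMeasure_quotientMeasure _ t _ νw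
  haveI : IsFiniteMeasureOnCompacts μq := inferInstance
  have hμq0 : μq ≠ 0 := quotientMeasure_ne_zero _ t _ νw
  have he : Continuous φ.toMulEquiv := φ.continuous
  have hes : Continuous φ.toMulEquiv.symm := φ.symm.continuous
  set μ' := μq.map (cosetCongr φ.toMulEquiv (chartTorusGLoc L ![(2 : L)⁻¹, 1, -(2 : L)⁻¹] w S') (torusU (starRingEnd ℂ) J) hφT) with hμ'
  haveI : SMulInvariantMeasure ↥(unitaryGroupOfForm (starRingEnd ℂ) J) (↥(unitaryGroupOfForm (starRingEnd ℂ) J) ⧸ torusU (starRingEnd ℂ) J) μ' :=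
    Literature.MeasureTheory.Group.smulInvariantMeasure_map_cosetCongr_of_smulInvariantMeasure φ.toMulEquiv _ _ hφT he μq
  haveI : IsFiniteMeasureOnCompacts μ' :=
    Literature.MeasureTheory.Group.isFiniteMeasureOnCompacts_map_cosetCongr φ.toMulEquiv _ _ hφT he hes μq
  have hμ'0 : μ' ≠ 0 := map_cosetCongr_subgroup_ne_zero φ.toMulEquiv he _ _ hφT hμq0
  obtain ⟨C, hCpos, hμC⟩ := exists_measure_quotient_torusU_complex_three_eq_smul_map hJ hK hKB κ αT μN μ' hμ'0
  -- the neighbourhood: pull `U` back along `Ad(T)⁻¹`, take a closed ball inside, fix the thresholds `η`, `R₀`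
  have hζn : ‖(ζ : ℂ)‖ = 1 := Circle.norm_coe ζ
  have hζ0 : (ζ : ℂ) ≠ 0 := Circle.coe_ne_zero ζ
  set U' : Set (Matrix (Fin 3) (Fin 3) ℂ) := (fun Y => ((T⁻¹ : GL (Fin 3) ℂ) : Matrix (Fin 3) (Fin 3) ℂ) * Y * ((T : GL (Fin 3) ℂ) : Matrix (Fin 3) (Fin 3) ℂ)) ⁻¹' U with hU'
  have hU' : U' ∈ 𝓝 ((ζ : ℂ) • (1 : Matrix (Fin 3) (Fin 3) ℂ)) := by
    have hc : Continuous fun Y : Matrix (Fin 3) (Fin 3) ℂ => ((T⁻¹ : GL (Fin 3) ℂ) : Matrix (Fin 3) (Fin 3) ℂ) * Y * ((T : GL (Fin 3) ℂ) : Matrix (Fin 3) (Fin 3) ℂ) :=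
      (continuous_const.mul continuous_id).mul continuous_const
    refine hc.continuousAt.preimage_mem_nhds ?_
    have e : ((T⁻¹ : GL (Fin 3) ℂ) : Matrix (Fin 3) (Fin 3) ℂ) * ((ζ : ℂ) • (1 : Matrix (Fin 3) (Fin 3) ℂ)) * ((T : GL (Fin 3) ℂ) : Matrix (Fin 3) (Fin 3) ℂ) =
        (ζ : ℂ) • (1 : Matrix (Fin 3) (Fin 3) ℂ) := by
      rw [Matrix.mul_smul, Matrix.mul_one, Matrix.smul_mul, Units.inv_mul]
    rwa [e]
  obtain ⟨r, hr, hrU⟩ := Metric.nhds_basis_closedBall.mem_iff.1 hU'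
  set η : ℝ := min (1 / 3) (r ^ 2 / 9) with hη
  have hηpos : 0 < η := lt_min (by norm_num) (by positivity)
  have hη3 : η ≤ 1 / 3 := min_le_left _ _
  have hηr : η ≤ r ^ 2 / 9 := min_le_right _ _
  set R₀ : ℝ := η ^ 2 / 3600 with hR₀
  have hR₀pos : 0 < R₀ := by positivity
  -- the profile (★ P) and the cut-off
  obtain ⟨β, hβs, -, hβR, hβ0, hnull⟩ := Literature.Analysis.SpecialFunctions.exists_contDiff_shellNullProfile (ε := R₀ / 2) (R := R₀) (by positivity) (by linarith)
  set χ : ℝ → ℝ := fun s => 1 - Real.smoothTransition ((s - η / 2) / (η / 2)) with hχ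
  have hχs : ContDiff ℝ ∞ χ := contDiff_const.sub (Real.smoothTransition.contDiff.comp ((contDiff_id.sub contDiff_const).div_const _))
  have hχ1 : ∀ s, s ≤ η / 2 → χ s = 1 := fun s hs => by
    simp only [hχ]
    rw [Real.smoothTransition.zero_of_nonpos (div_nonpos_of_nonpos_of_nonneg (by linarith) (by positivity)), sub_zero]
  have hχ0 : ∀ s, η ≤ s → χ s = 0 := fun s hs => by
    simp only [hχ]
    rw [Real.smoothTransition.one_of_one_le ((one_le_div (by positivity)).2 (by linarith)), sub_self]
  -- the bump and the ambient test function
  set ψ : Matrix (Fin 3) (Fin 3) ℂ → ℝ := fun Y =>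
    β (∑ i, ∑ j, ‖cayley ((ζ : ℂ)⁻¹ • Y) i j‖ ^ 2) * χ (∑ i, ∑ j, ‖((ζ : ℂ)⁻¹ • Y - 1) i j‖ ^ 2) with hψ
  have hψs : ContDiff ℝ ∞ ψ := contDiff_radialCayleyBump β χ (ζ : ℂ) hβs hχs hη3 hχ0
  obtain ⟨hψcs, hψU'⟩ := hasCompactSupport_radialCayleyBump β χ (ζ : ℂ) hχ0 hr hηr hζn hrU
  set A : Matrix (Fin 3) (Fin 3) ℂ ≃ₜ Matrix (Fin 3) (Fin 3) ℂ :=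
    { toFun := fun X => ((T : GL (Fin 3) ℂ) : Matrix (Fin 3) (Fin 3) ℂ) * X * ((T⁻¹ : GL (Fin 3) ℂ) : Matrix (Fin 3) (Fin 3) ℂ)
      invFun := fun Y => ((T⁻¹ : GL (Fin 3) ℂ) : Matrix (Fin 3) (Fin 3) ℂ) * Y * ((T : GL (Fin 3) ℂ) : Matrix (Fin 3) (Fin 3) ℂ)
      left_inv := fun X => by
        show ((T⁻¹ : GL (Fin 3) ℂ) : Matrix (Fin 3) (Fin 3) ℂ) * (((T : GL (Fin 3) ℂ) : Matrix (Fin 3) (Fin 3) ℂ) * X * ((T⁻¹ : GL (Fin 3) ℂ) : Matrix (Fin 3) (Fin 3) ℂ)) *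
          ((T : GL (Fin 3) ℂ) : Matrix (Fin 3) (Fin 3) ℂ) = X
        rw [← mul_assoc, ← mul_assoc, Units.inv_mul, one_mul, mul_assoc, Units.inv_mul, mul_one]
      right_inv := fun Y => by
        show ((T : GL (Fin 3) ℂ) : Matrix (Fin 3) (Fin 3) ℂ) * (((T⁻¹ : GL (Fin 3) ℂ) : Matrix (Fin 3) (Fin 3) ℂ) * Y * ((T : GL (Fin 3) ℂ) : Matrix (Fin 3) (Fin 3) ℂ)) *
          ((T⁻¹ : GL (Fin 3) ℂ) : Matrix (Fin 3) (Fin 3) ℂ) = Y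
        rw [← mul_assoc, ← mul_assoc, Units.mul_inv, one_mul, mul_assoc, Units.mul_inv, mul_one]
      continuous_toFun := (continuous_const.mul continuous_id).mul continuous_const
      continuous_invFun := (continuous_const.mul continuous_id).mul continuous_const } with hA
  set fa : Matrix (Fin 3) (Fin 3) ℂ → ℂ := fun X => ((ψ (A X) : ℝ) : ℂ) with hfa
  have hfa_s : ContDiff ℝ ∞ fa :=
    Complex.ofRealCLM.contDiff.comp (hψs.comp ((contDiff_const.mul contDiff_id).mul contDiff_const))
  have hψA : HasCompactSupport (ψ ∘ A) := hψcs.comp_homeomorph A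
  have hfa_cs : HasCompactSupport fa := by
    have h := hψA.comp_left (g := fun x : ℝ => (x : ℂ)) Complex.ofReal_zero
    exact h
  have htsA : tsupport (ψ ∘ A) ⊆ U := by
    intro X hX
    have h1 : tsupport (ψ ∘ (A : Matrix (Fin 3) (Fin 3) ℂ → Matrix (Fin 3) (Fin 3) ℂ)) = A ⁻¹' tsupport ψ := by
      rw [tsupport, tsupport, Function.support_comp_eq_preimage, A.preimage_closure]
    rw [h1] at hX
    have h2 : A.symm (A X) ∈ U := hψU' hX
    rwa [A.symm_apply_apply] at h2
  have hfa_ts : tsupport fa ⊆ U := (tsupport_comp_subset Complex.ofReal_zero _).trans htsA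
  -- the restriction to the group: `fa ↑↑g = ψ ↑↑(φ g)`
  have hfaφ : ∀ g : ↥(archLocal L 3 (Matrix.diagonal ![(2 : L)⁻¹, 1, -(2 : L)⁻¹]) w), fa ((g : GL (Fin 3) ℂ) : Matrix (Fin 3) (Fin 3) ℂ) = ((ψ (((φ g : ↥(unitaryGroupOfForm (starRingEnd ℂ) J)) : GL (Fin 3) ℂ) : Matrix (Fin 3) (Fin 3) ℂ) : ℝ) : ℂ) := fun g => by
    simp only [hfa]
    congr 2
    show ((T : GL (Fin 3) ℂ) : Matrix (Fin 3) (Fin 3) ℂ) * ((g : GL (Fin 3) ℂ) : Matrix (Fin 3) (Fin 3) ℂ) * ((T⁻¹ : GL (Fin 3) ℂ) : Matrix (Fin 3) (Fin 3) ℂ) = _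
    rw [hT g, Units.val_mul, Units.val_mul]
  have hfa_grp : HasCompactSupport (fun g : ↥(archLocal L 3 (Matrix.diagonal ![(2 : L)⁻¹, 1, -(2 : L)⁻¹]) w) => fa ((g : GL (Fin 3) ℂ) : Matrix (Fin 3) (Fin 3) ℂ)) := by
    refine HasCompactSupport.intro (isCompact_setOf_coe_archLocal_mem L 3 ![(2 : L)⁻¹, 1, -(2 : L)⁻¹] w hα hfa_cs.isCompact) fun g hg => ?_
    exact image_eq_zero_of_notMem_tsupport (by simpa using hg)
  -- the letter (★, hypothesis-free) and `ℓ`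
  obtain ⟨c, hc, hlim⟩ := Literature.NumberTheory.Rogawski1990.ArchCentralLimitFormulaRankTwo.exists_pos_of_frame
    (Literature.NumberTheory.Rogawski1990.ArchCentralLimitFormulaRankTwo_holds L ![(2 : L)⁻¹, 1, -(2 : L)⁻¹] w) hα
    (im_embedding_quasiSplitWeights_eq_zero L w) νw
  set ℓ : ℂ := -((c : ℂ) * Complex.I) * fa ((circleDiagonal 3 (fun _ => ζ) : GL (Fin 3) ℂ) : Matrix (Fin 3) (Fin 3) ℂ) with hℓ
  have hcorner : fa ((circleDiagonal 3 (fun _ => ζ) : GL (Fin 3) ℂ) : Matrix (Fin 3) (Fin 3) ℂ) = ((β 0 * χ 0 : ℝ) : ℂ) := by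
    have e1 : ((circleDiagonal 3 (fun _ => ζ) : GL (Fin 3) ℂ) : Matrix (Fin 3) (Fin 3) ℂ) = (ζ : ℂ) • (1 : Matrix (Fin 3) (Fin 3) ℂ) := by
      rw [coe_circleDiagonal, Matrix.smul_one_eq_diagonal]
    have e2 : A ((ζ : ℂ) • (1 : Matrix (Fin 3) (Fin 3) ℂ)) = (ζ : ℂ) • (1 : Matrix (Fin 3) (Fin 3) ℂ) := by
      show ((T : GL (Fin 3) ℂ) : Matrix (Fin 3) (Fin 3) ℂ) * ((ζ : ℂ) • (1 : Matrix (Fin 3) (Fin 3) ℂ)) * ((T⁻¹ : GL (Fin 3) ℂ) : Matrix (Fin 3) (Fin 3) ℂ) = _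
      rw [Matrix.mul_smul, Matrix.mul_one, Matrix.smul_mul, Units.mul_inv]
    simp only [hfa, e1, e2, hψ, smul_smul, inv_mul_cancel₀ hζ0, one_smul, sub_self, cayley_def, sub_self, zero_mul, Matrix.zero_apply,
      norm_zero, zero_pow two_ne_zero, Finset.sum_const_zero]
  have hℓ0 : ℓ ≠ 0 := by
    rw [hℓ, hcorner, hχ1 0 (by positivity), mul_one]
    refine mul_ne_zero (neg_ne_zero.2 (mul_ne_zero (by exact_mod_cast hc.ne') Complex.I_ne_zero)) (by exact_mod_cast hβ0.ne')
  refine ⟨fa, ℓ, R₀ / 2, by positivity, hfa_s, hfa_cs, hfa_ts, hfa_grp, hℓ0, fun θ₁ θ₂ hθ₁ hθ₂ cw hx hc0 hc1 hcρ => ?_, hlim fa hfa_s hfa_grp ζ⟩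
  -- (G1-c): the explicit vanishing set around the lift `(0, θ₁, θ₂)`
  have hθ₁' : Complex.exp ((θ₁ : ℂ) * I) = (ζ : ℂ) := by rw [← hθ₁, Circle.coe_exp]
  have hθ₂' : Complex.exp ((θ₂ : ℂ) * I) = (ζ : ℂ) := by rw [← hθ₂, Circle.coe_exp]
  have hfun : (fun g : ↥(archLocal L 3 (Matrix.diagonal ![(2 : L)⁻¹, 1, -(2 : L)⁻¹]) w) => fa ((g : GL (Fin 3) ℂ) : Matrix (Fin 3) (Fin 3) ℂ)) =
      fun g => ((β (∑ i, ∑ j, ‖cayley ((ζ : ℂ)⁻¹ • (((φ g : ↥(unitaryGroupOfForm (starRingEnd ℂ) J)) : GL (Fin 3) ℂ) : Matrix (Fin 3) (Fin 3) ℂ)) i j‖ ^ 2) *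
        χ (∑ i, ∑ j, ‖((ζ : ℂ)⁻¹ • (((φ g : ↥(unitaryGroupOfForm (starRingEnd ℂ) J)) : GL (Fin 3) ℂ) : Matrix (Fin 3) (Fin 3) ℂ) - 1) i j‖ ^ 2) : ℝ) : ℂ) := by
    funext g
    rw [hfaφ g]
  rw [hfun]
  exact chartOrbGLoc_radialCayleyBump_eq_zero L ![(2 : L)⁻¹, 1, -(2 : L)⁻¹] w S' φ hφT hφd τ hτT hτcoe hτmul hτd νw t hJ κ μN hμC hKU
    β χ hβs hχs hηpos hη3 hχ0 hχ1 le_rfl hβR hnull (ζ : ℂ) hζn θ₁ θ₂ hθ₁' hθ₂' cw hx hc0 hc1 hcρ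

/-- **(B) THE CORNER EULER–POINCARÉ GENERATOR — NEIGHBOURHOOD FORM** (the (B6′) head of record, LH2-plan 16:11:33Z ∕ 16:35:25Z): as `exists_centralType_generator_explicit`, with
the vanishing stated on SOME neighbourhood `V` of every corner lift `(0, θ₁, θ₂)` (from the explicit set by continuity of `boostEig`).
[cite: Rogawski1990, §4.9 (4.9.2) p. 55; §8.4 pp. 126–127] [cite: Varadarajan1977, I §1.12] [cite: HarishChandra1975HARRG1, §17 Lemma 17.5] -/
theorem exists_centralType_generator
    [MeasurableSpace ↥(archLocal L 3 (Matrix.diagonal ![(2 : L)⁻¹, 1, -(2 : L)⁻¹]) w)] [BorelSpace ↥(archLocal L 3 (Matrix.diagonal ![(2 : L)⁻¹, 1, -(2 : L)⁻¹]) w)] [LocallyCompactSpace ↥(archLocal L 3 (Matrix.diagonal ![(2 : L)⁻¹, 1, -(2 : L)⁻¹]) w)] [SecondCountableTopology ↥(archLocal L 3 (Matrix.diagonal ![(2 : L)⁻¹, 1, -(2 : L)⁻¹]) w)]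
    (νw : Measure ↥(archLocal L 3 (Matrix.diagonal ![(2 : L)⁻¹, 1, -(2 : L)⁻¹]) w)) [νw.IsHaarMeasure] [νw.IsMulRightInvariant]
    (S' : Finset {w : InfinitePlace L // IsComplex w}) (hS' : w ∈ S')
    (ζ : Circle) {U : Set (Matrix (Fin 3) (Fin 3) ℂ)} (hU : U ∈ 𝓝 ((ζ : ℂ) • (1 : Matrix (Fin 3) (Fin 3) ℂ))) :
    ∃ (fa : Matrix (Fin 3) (Fin 3) ℂ → ℂ) (ℓ : ℂ),
      ContDiff ℝ ∞ fa ∧ HasCompactSupport fa ∧ tsupport fa ⊆ U ∧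
      HasCompactSupport (fun g : ↥(archLocal L 3 (Matrix.diagonal ![(2 : L)⁻¹, 1, -(2 : L)⁻¹]) w) => fa ((g : GL (Fin 3) ℂ) : Matrix (Fin 3) (Fin 3) ℂ)) ∧ ℓ ≠ 0 ∧
      (∀ θ₁ θ₂ : ℝ, Circle.exp θ₁ = ζ → Circle.exp θ₂ = ζ →
        ∃ V ∈ 𝓝 (![0, θ₁, θ₂] : Fin 3 → ℝ), ∀ cw ∈ V, cw 0 ≠ 0 →
          chartOrbGLoc L ![(2 : L)⁻¹, 1, -(2 : L)⁻¹] w S' νw (fun g : ↥(archLocal L 3 (Matrix.diagonal ![(2 : L)⁻¹, 1, -(2 : L)⁻¹]) w) => fa ((g : GL (Fin 3) ℂ) : Matrix (Fin 3) (Fin 3) ℂ)) cw = 0) ∧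
      Tendsto (fun z : Fin 3 → Circle =>
          (1 / 48 : ℂ) * ∑ ε : Fin 3 → Bool, ((((if ε 0 then (1 : ℝ) else -1) * (if ε 1 then (1 : ℝ) else -1) * (if ε 2 then (1 : ℝ) else -1) : ℝ)) : ℂ) *
            iteratedDeriv 3 (fun s : ℝ => ((((z 0 * Circle.exp (s * (![(if ε 0 then (1 : ℝ) else -1) + (if ε 1 then (1 : ℝ) else -1), -(if ε 0 then (1 : ℝ) else -1) + (if ε 2 then (1 : ℝ) else -1), -(if ε 1 then (1 : ℝ) else -1) - (if ε 2 then (1 : ℝ) else -1)] 0)) : Circle) : ℂ)) * (((z 2 * Circle.exp (s * (![(if ε 0 then (1 : ℝ) else -1) + (if ε 1 then (1 : ℝ) else -1), -(if ε 0 then (1 : ℝ) else -1) + (if ε 2 then (1 : ℝ) else -1), -(if ε 1 then (1 : ℝ) else -1) - (if ε 2 then (1 : ℝ) else -1)] 2)) : Circle) : ℂ))⁻¹) * ((1 - (((z 1 * Circle.exp (s * (![(if ε 0 then (1 : ℝ) else -1) + (if ε 1 then (1 : ℝ) else -1), -(if ε 0 then (1 : ℝ) else -1) + (if ε 2 then (1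 : ℝ) else -1), -(if ε 1 then (1 : ℝ) else -1) - (if ε 2 then (1 : ℝ) else -1)] 1)) : Circle) : ℂ)) * (((z 0 * Circle.exp (s * (![(if ε 0 then (1 : ℝ) else -1) + (if ε 1 then (1 : ℝ) else -1), -(if ε 0 then (1 : ℝ) else -1) + (if ε 2 then (1 : ℝ) else -1), -(if ε 1 then (1 : ℝ) else -1) - (if ε 2 then (1 : ℝ) else -1)] 0)) : Circle) : ℂ))⁻¹) * (1 - (((z 2 * Circle.exp (s * (![(if ε 0 then (1 : ℝ) else -1) + (if ε 1 then (1 : ℝ) else -1), -(if ε 0 then (1 : ℝ) else -1) + (if ε 2 then (1 : ℝ) else -1), -(if ε 1 then (1 : ℝ) else -1) - (if ε 2 then (1 : ℝ) else -1)] 2)) : Circle) : ℂ)) * (((z 1 * Circle.exp (s * (![(if ε 0 then (1 : ℝ) else -1) + (if ε 1 then (1 : ℝ) else -1), -(if ε 0 then (1 : ℝ) else -1) + (if ε 2 then (1 : ℝ) else -1), -(if ε 1 then (1 : ℝ) else -1) - (if ε 2 then (1 : ℝ) else -1)] 1)) : Circle) : ℂ))⁻¹) * (1 - (((z 2 * Circle.exp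 (s * (![(if ε 0 then (1 : ℝ) else -1) + (if ε 1 then (1 : ℝ) else -1), -(if ε 0 then (1 : ℝ) else -1) + (if ε 2 then (1 : ℝ) else -1), -(if ε 1 then (1 : ℝ) else -1) - (if ε 2 then (1 : ℝ) else -1)] 2)) : Circle) : ℂ)) * (((z 0 * Circle.exp (s * (![(if ε 0 then (1 : ℝ) else -1) + (if ε 1 then (1 : ℝ) else -1), -(if ε 0 then (1 : ℝ) else -1) + (if ε 2 then (1 : ℝ) else -1), -(if ε 1 then (1 : ℝ) else -1) - (if ε 2 then (1 : ℝ) else -1)] 0)) : Circle) : ℂ))⁻¹)) * (∫ g, fa (((g * ⟨circleDiagonal 3 (fun k => z k * Circle.exp (s * (![(if ε 0 then (1 : ℝ) else -1) + (if ε 1 then (1 : ℝ) else -1), -(if ε 0 then (1 : ℝ) else -1) + (if ε 2 then (1 : ℝ) else -1), -(if ε 1 then (1 : ℝ) else -1) - (if ε 2 then (1 : ℝ) else -1)] k))), circleDiagonal_mem_archLocal_diagonal L 3 ![(2 : L)⁻¹, 1, -(2 : L)⁻¹] w _⟩ * g⁻¹ : archLocal L 3 (Matrix.diagonal ![(2 :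 L)⁻¹, 1, -(2 : L)⁻¹]) w) : GL (Fin 3) ℂ) : Matrix (Fin 3) (Fin 3) ℂ) ∂νw)) 0)
        (𝓝[{z : Fin 3 → Circle | Function.Injective z}] (fun _ => ζ))
        (𝓝 ℓ) := by
  obtain ⟨fa, ℓ, ε', hε', h1, h2, h3, h4, h5, hvan, hlim⟩ := exists_centralType_generator_explicit L w νw S' hS' ζ hU
  refine ⟨fa, ℓ, h1, h2, h3, h4, h5, fun θ₁ θ₂ hθ₁ hθ₂ => ?_, hlim⟩
  set p : Fin 3 → ℝ := ![0, θ₁, θ₂] with hp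
  have hbc : ∀ i, Continuous fun cw : Fin 3 → ℝ => boostEig (cw - p) i := fun i => by
    have hl : Continuous fun cw : Fin 3 → ℝ => cw - p := continuous_id.sub continuous_const
    fin_cases i
    · exact (Complex.continuous_exp.comp ((Complex.continuous_ofReal.comp ((continuous_apply 0).comp hl)).add
        ((Complex.continuous_ofReal.comp ((continuous_apply 2).comp hl)).mul continuous_const)))
    · exact (Complex.continuous_exp.comp ((Complex.continuous_ofReal.comp ((continuous_apply 1).comp hl)).mul continuous_const))
    · exact (Complex.continuous_exp.comp ((Complex.continuous_ofReal.comp ((continuous_apply 0).comp hl)).neg.add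
        ((Complex.continuous_ofReal.comp ((continuous_apply 2).comp hl)).mul continuous_const)))
  have hb0 : ∀ i, boostEig (p - p) i = 1 := fun i => by
    rw [sub_self, boostEig_apply_eq]
    fin_cases i <;> simp
  have h2' : ∀ i, (1 : ℂ) + boostEig (p - p) i ≠ 0 := fun i => by rw [hb0]; norm_num
  have hne_ev : ∀ i, ∀ᶠ cw in 𝓝 p, 1 + boostEig (cw - p) i ≠ 0 := fun i =>
    (continuous_const.add (hbc i)).continuousAt.eventually_ne (h2' i)
  have hρc : ContinuousAt (fun cw : Fin 3 → ℝ => ∑ i, ‖(1 - boostEig (cw - p) i) / (1 + boostEig (cw - p) i)‖ ^ 2) p := by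
    refine tendsto_finsetSum _ fun i _ => ?_
    exact ((((continuous_const.sub (hbc i)).continuousAt).div ((continuous_const.add (hbc i)).continuousAt) (h2' i)).norm.pow 2)
  have hρ0 : (∑ i, ‖(1 - boostEig (p - p) i) / (1 + boostEig (p - p) i)‖ ^ 2) < ε' := by
    have h0 : (∑ i, ‖(1 - boostEig (p - p) i) / (1 + boostEig (p - p) i)‖ ^ 2) = 0 := by
      refine Finset.sum_eq_zero fun i _ => ?_
      rw [hb0 i, sub_self, zero_div, norm_zero, zero_pow two_ne_zero]
    rw [h0]
    exact hε'
  have hρ_ev : ∀ᶠ cw in 𝓝 p, (∑ i, ‖(1 - boostEig (cw - p) i) / (1 + boostEig (cw - p) i)‖ ^ 2) < ε' := hρc.eventually_lt_const hρ0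
  refine ⟨{cw | 1 + boostEig (cw - p) 0 ≠ 0} ∩ {cw | 1 + boostEig (cw - p) 1 ≠ 0} ∩
    {cw | (∑ i, ‖(1 - boostEig (cw - p) i) / (1 + boostEig (cw - p) i)‖ ^ 2) < ε'},
    Filter.inter_mem (Filter.inter_mem (hne_ev 0) (hne_ev 1)) hρ_ev, fun cw hcw hx => ?_⟩
  obtain ⟨⟨hc0, hc1⟩, hcρ⟩ := hcw
  exact hvan θ₁ θ₂ hθ₁ hθ₂ cw hx hc0 hc1 hcρ

end Head

end Literature.NumberTheory.Automorphic.UnitaryGroup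

end
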